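import Literature.MathematicalPhysics.KineticTheory.ReyBelletThomas2002SmoothDensity
import Literature.Analysis.Distribution.BracketGeneratingLift
import HarnessLib

/-!
# Rey-Bellet–Thomas 2002, Prop. 4.1 without the bare drift, and the bracket condition for `L* - ∂_t`

Trunk T-KINETIC (Literature/MathematicalPhysics/KineticTheory). Inline decomposition step for the
named fact `ReyBelletThomas2002_thm21` (provefact unit), toward its "`C^∞` law" clause: §4 p. 26
applies Hörmander's theorem to the PARABOLIC problem ("the Markov process has a `C^∞` law"), whose
operator on `ℝ × X` is `L*_y - ∂_t` with the fields `X̃_b = (0, X_b)`, `X̃₀ = (-1, -X₀)`. By the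
generic lift `Literature.Analysis.Distribution.isBracketGenerating_lift`
(`BracketGeneratingLift.lean`) its bracket condition follows from the bracket condition of
`(X₀, X_L, X_R)` on `X` established WITHOUT the bare word `X₀`, which is what the printed sweep of
Prop. 4.1 does (it starts from `∂_{r_b}` and only brackets). This file re-runs the sweep of
`ReyBelletThomas2002Hormander.lean` inside the restricted germ module `InGermModuleMod` (allowed
bare words: the noise fields) and concludes:

* `OscillatorChain.bracketSpanModAt_rbHormanderFamily_eq_top`,
  `OscillatorChain.bracketSpanModAt_rbAdjointFamily_eq_top` — Prop. 4.1 without the bare drift,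
  for `L` and for `L*`;
* `OscillatorChain.rbParabolicFamily` — the family `(X̃₀, X̃_L, X̃_R)` of `L* - ∂_t` on
  `ℝ × X`, and **`OscillatorChain.isBracketGenerating_rbParabolicFamily`** — its bracket condition
  everywhere (H2, `Λ ≠ 0`, `γT_L, γT_R > 0`).

## References

* L. Rey-Bellet, L. E. Thomas, Comm. Math. Phys. **225** (2002) 305–329, Prop. 4.1 and §4 p. 26.
* L. Hörmander, Acta Math. **119** (1967) 147–171, Thm 1.1.
-/

noncomputable section

open Set Filter VectorField Finset
open scoped ContDiff Topology

namespace Literature.MathematicalPhysics.KineticTheory.HeatConduction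

open Literature.Analysis.Distribution

variable {N : ℕ}

namespace OscillatorChain

variable (P : OscillatorChain)

/-! ### The sweep of Prop. 4.1 in the restricted germ module -/

section Brackets

variable {P} {Λ : ℝ} {T_L T_R : ℝ} (hU : ContDiff ℝ ∞ P.U) (hV : ContDiff ℝ ∞ P.V)
  {A : Set (Option (Fin 2))} (hA : ∀ b : Fin 2, some b ∈ A)
include hU hV

omit hU hV in
include hA in
/-- `∂_{r_L}` is in the germ module (indeed in `lieSpan`): `X_L = √(γT_L) ∂_{r_L}`, `γT_L > 0`.
[cite: ReyBelletThomas2002, Prop 4.1] -/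
theorem inGermModuleMod_rbUnitRL (hL : 0 < P.γ * T_L) (x₀ : RBPhaseSpace N) :
    InGermModuleMod (P.rbHormanderFamily Λ N T_L T_R) A x₀ (fun _ => rbUnitRL) := by
  have hs : Real.sqrt (P.γ * T_L) ≠ 0 := Real.sqrt_ne_zero'.2 hL
  have h : InGermModuleMod (P.rbHormanderFamily Λ N T_L T_R) A x₀
      ((Real.sqrt (P.γ * T_L))⁻¹ • P.rbHormanderFamily Λ N T_L T_R (some 0)) :=
    (InGermModuleMod.mem (mem_lieSpanMod_of (hA 0))).const_smul _
  have e : ((Real.sqrt (P.γ * T_L))⁻¹ • P.rbHormanderFamily Λ N T_L T_R (some 0)) =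
      fun _ => (rbUnitRL : RBPhaseSpace N) := by
    funext y
    simp [rbHormanderFamily, rbBathField, rbBathVec, bathTemp, smul_smul, inv_mul_cancel₀ hs]
  rwa [e] at h

omit hU hV in
include hA in
/-- `∂_{r_R}` is in the germ module: `X_R = √(γT_R) ∂_{r_R}`, `γT_R > 0`.
[cite: ReyBelletThomas2002, Prop 4.1] -/
theorem inGermModuleMod_rbUnitRR (hR : 0 < P.γ * T_R) (x₀ : RBPhaseSpace N) :
    InGermModuleMod (P.rbHormanderFamily Λ N T_L T_R) A x₀ (fun _ => rbUnitRR) := by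
  have hs : Real.sqrt (P.γ * T_R) ≠ 0 := Real.sqrt_ne_zero'.2 hR
  have h : InGermModuleMod (P.rbHormanderFamily Λ N T_L T_R) A x₀
      ((Real.sqrt (P.γ * T_R))⁻¹ • P.rbHormanderFamily Λ N T_L T_R (some 1)) :=
    (InGermModuleMod.mem (mem_lieSpanMod_of (hA 1))).const_smul _
  have e : ((Real.sqrt (P.γ * T_R))⁻¹ • P.rbHormanderFamily Λ N T_L T_R (some 1)) =
      fun _ => (rbUnitRR : RBPhaseSpace N) := by
    funext y
    simp [rbHormanderFamily, rbBathField, rbBathVec, bathTemp, smul_smul, inv_mul_cancel₀ hs]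
  rwa [e] at h

/-- The bracket of a constant field `v` in the germ module with `X₀` puts `y ↦ DX₀(y)·v` in the
germ module. [folklore] -/
theorem inGermModuleMod_fderiv_rbDrift {x₀ v : RBPhaseSpace N}
    (hv : InGermModuleMod (P.rbHormanderFamily Λ N T_L T_R) A x₀ (fun _ => v)) :
    InGermModuleMod (P.rbHormanderFamily Λ N T_L T_R) A x₀ fun y => fderiv ℝ (P.rbDrift Λ N) y v := by
  have h := hv.lieBracket_family_right (P.rbHormanderFamily_smooth hU hV Λ N T_L T_R) none
  rwa [show P.rbHormanderFamily Λ N T_L T_R none = P.rbDrift Λ N from rfl,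
    lieBracket_const_left] at h

include hA in
/-- **Momentum ⇒ position**: if `∂_{p_i}` is in the germ module then so is `∂_{q_i}`
(`[∂_{p_i}, X₀] = ∂_{q_i} + Λ([i = 0] ∂_{r_L} + [i = N-1] ∂_{r_R})`; RBT: "yield the vector fields
`∂_{p₁}` and `∂_{q₁}`"). [cite: ReyBelletThomas2002, Prop 4.1] -/
theorem inGermModuleMod_rbUnitQ_of_rbUnitP (hL : 0 < P.γ * T_L) (hR : 0 < P.γ * T_R)
    {x₀ : RBPhaseSpace N} {i : Fin N}
    (hi : InGermModuleMod (P.rbHormanderFamily Λ N T_L T_R) A x₀ (fun _ => rbUnitP i)) :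
    InGermModuleMod (P.rbHormanderFamily Λ N T_L T_R) A x₀ (fun _ => rbUnitQ i) := by
  have h := P.inGermModuleMod_fderiv_rbDrift hU hV hi
  simp only [P.fderiv_rbDrift_rbUnitP hU hV, mk_single_eq_rbUnitQ_add] at h
  have h' := h.sub ((((P.inGermModuleMod_rbUnitRL hA hL x₀).const_smul
    (Λ * (if i.val = 0 then 1 else 0))).add
    ((P.inGermModuleMod_rbUnitRR hA hR x₀).const_smul (Λ * (if i.val = N - 1 then 1 else 0)))))
  have e : ((fun _ : RBPhaseSpace N => (rbUnitQ i : RBPhaseSpace N) +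
      (Λ * (if i.val = 0 then 1 else 0)) • rbUnitRL + (Λ * (if i.val = N - 1 then 1 else 0)) • rbUnitRR) -
      ((Λ * (if i.val = 0 then 1 else 0)) • (fun _ : RBPhaseSpace N => (rbUnitRL : RBPhaseSpace N)) +
        (Λ * (if i.val = N - 1 then 1 else 0)) • (fun _ : RBPhaseSpace N => (rbUnitRR : RBPhaseSpace N)))) =
      fun _ => rbUnitQ i := by
    funext y
    simp only [Pi.sub_apply, Pi.add_apply, Pi.smul_apply]
    abel
  rwa [e] at h'

include hA in
/-- **The left reservoir yields `∂_{p_0}`**: `[∂_{r_L}, X₀] = -Λ ∂_{p_0} - γ ∂_{r_L}`, `Λ ≠ 0`.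
[cite: ReyBelletThomas2002, Prop 4.1] -/
theorem inGermModuleMod_rbUnitP_zero (hΛ : Λ ≠ 0) (hL : 0 < P.γ * T_L) (x₀ : RBPhaseSpace N)
    (i : Fin N) (hi : i.val = 0) :
    InGermModuleMod (P.rbHormanderFamily Λ N T_L T_R) A x₀ (fun _ => rbUnitP i) := by
  have h := P.inGermModuleMod_fderiv_rbDrift (Λ := Λ) (T_L := T_L) (T_R := T_R) hU hV
    (P.inGermModuleMod_rbUnitRL hA hL x₀)
  simp only [P.fderiv_rbDrift_rbUnitRL hU hV, mk_col_zero_eq i hi] at h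
  have h' := (h.sub ((P.inGermModuleMod_rbUnitRL hA hL x₀).const_smul (-P.γ))).const_smul (-Λ)⁻¹
  have e : (-Λ)⁻¹ • ((fun _ : RBPhaseSpace N => (-Λ) • (rbUnitP i : RBPhaseSpace N) +
      (-P.γ) • rbUnitRL) - (-P.γ) • (fun _ : RBPhaseSpace N => (rbUnitRL : RBPhaseSpace N))) =
      fun _ => rbUnitP i := by
    funext y
    simp only [Pi.smul_apply, Pi.sub_apply, add_sub_cancel_right, smul_smul,
      inv_mul_cancel₀ (neg_ne_zero.2 hΛ), one_smul]
  rwa [e] at h'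

/-- **The column `DX₀·∂_{q_{i'}}` modulo known directions**: if `∂_{q_{i'}}` and all `∂_{p_l}`,
`l ≤ i'`, are in the germ module and `i = i' + 1`, then so is `y ↦ V''(q_i - q_{i'}) ∂_{p_i}`
(`[∂_{q_{i'}}, X₀] = -∑_l ∂²Φ/∂q_{i'}∂q_l ∂_{p_l}` is tridiagonal with the entry
`-∂²Φ/∂q_{i'}∂q_i = V''(q_i - q_{i'})`). [cite: ReyBelletThomas2002, Prop 4.1] -/
theorem inGermModuleMod_hess_smul_rbUnitP {x₀ : RBPhaseSpace N} {i i' : Fin N}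
    (hii' : i.val = i'.val + 1)
    (hQ : InGermModuleMod (P.rbHormanderFamily Λ N T_L T_R) A x₀ (fun _ => rbUnitQ i'))
    (hPl : ∀ l : Fin N, l.val ≤ i'.val →
      InGermModuleMod (P.rbHormanderFamily Λ N T_L T_R) A x₀ (fun _ => rbUnitP l)) :
    InGermModuleMod (P.rbHormanderFamily Λ N T_L T_R) A x₀
      (fun y => deriv (deriv P.V) (y.1.1 i - y.1.1 i') • (rbUnitP i : RBPhaseSpace N)) := by
  have h := P.inGermModuleMod_fderiv_rbDrift hU hV hQ
  simp only [P.fderiv_rbDrift_rbUnitQ hU hV] at h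
  -- the column as a sum over `l`
  have hcol : (fun y : RBPhaseSpace N =>
      ((((0 : Fin N → ℝ), fun l : Fin N => -P.hessPotential N l i' y.1.1), ((0 : ℝ), (0 : ℝ))) :
        RBPhaseSpace N)) =
      ∑ l : Fin N, fun y => (-P.hessPotential N l i' y.1.1) • (rbUnitP l : RBPhaseSpace N) := by
    funext y
    rw [Finset.sum_apply]
    refine Prod.ext (Prod.ext ?_ (funext fun j => ?_)) (Prod.ext ?_ ?_) <;>
      simp [rbUnitP, Prod.fst_sum, Prod.snd_sum, Finset.sum_apply, Pi.single_apply]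
  rw [hcol] at h
  -- split off the term `l = i`; the others are in the module or vanish
  rw [← Finset.add_sum_erase _ _ (Finset.mem_univ i)] at h
  have hrest : InGermModuleMod (P.rbHormanderFamily Λ N T_L T_R) A x₀
      (∑ l ∈ Finset.univ.erase i,
        fun y => (-P.hessPotential N l i' y.1.1) • (rbUnitP l : RBPhaseSpace N)) := by
    refine InGermModuleMod.finset_sum _ fun l hl => ?_
    have hli : l ≠ i := Finset.ne_of_mem_erase hl
    rcases Nat.lt_or_ge l.val i.val with hlt | hge
    · -- `l ≤ i'`: known direction, smooth coefficient
      have hsm : ContDiff ℝ ∞ fun y : RBPhaseSpace N => -P.hessPotential N l i' y.1.1 := by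
        have hc : ContDiff ℝ ∞ fun y : RBPhaseSpace N => fderiv ℝ (P.rbDrift Λ N) y (rbUnitQ i') :=
          ((P.contDiff_rbDrift hU hV Λ N).fderiv_right (m := ∞) (by exact_mod_cast le_top)).clm_apply
            contDiff_const
        have : (fun y : RBPhaseSpace N => -P.hessPotential N l i' y.1.1) =
            fun y => ((fderiv ℝ (P.rbDrift Λ N) y (rbUnitQ i')).1.2) l := by
          funext y
          rw [P.fderiv_rbDrift_rbUnitQ hU hV]
        rw [this]
        exact (contDiff_apply ℝ ℝ l).comp ((contDiff_snd.comp contDiff_fst).comp hc)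
      exact (hPl l (by omega)).smul (Eventually.of_forall fun y => hsm.contDiffAt)
    · -- `l ≥ i + 1 = i' + 2`: the Hessian entry vanishes identically
      have hl2 : i'.val + 2 ≤ l.val := by
        have : l.val ≠ i.val := fun e => hli (Fin.ext e)
        omega
      have : (fun y : RBPhaseSpace N =>
          (-P.hessPotential N l i' y.1.1) • (rbUnitP l : RBPhaseSpace N)) = 0 := by
        funext y
        rw [P.hessPotential_eq_zero_of_le N hl2, neg_zero, zero_smul]
        rfl
      rw [this]
      exact InGermModuleMod.zero
  have hmain := h.sub hrest
  rw [add_sub_cancel_right] at hmain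
  have e : (fun y : RBPhaseSpace N =>
      (-P.hessPotential N i i' y.1.1) • (rbUnitP i : RBPhaseSpace N)) =
      fun y => deriv (deriv P.V) (y.1.1 i - y.1.1 i') • (rbUnitP i : RBPhaseSpace N) := by
    funext y
    rw [P.hessPotential_succ N hii', neg_neg]
  rwa [e] at hmain

/-- All `Z_k`, `k ≥ 2`, are in the germ module once `Z_2` is and `∂_{q_{i'}}` is.
[cite: ReyBelletThomas2002, Prop 4.1] -/
theorem inGermModuleMod_bondCoeff_smul {x₀ : RBPhaseSpace N} {i i' : Fin N} (hii' : i ≠ i')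
    (hQ : InGermModuleMod (P.rbHormanderFamily Λ N T_L T_R) A x₀ (fun _ => rbUnitQ i'))
    (h2 : InGermModuleMod (P.rbHormanderFamily Λ N T_L T_R) A x₀
      (fun y => P.bondCoeff 2 i i' y • (rbUnitP i : RBPhaseSpace N))) (k : ℕ) (hk : 2 ≤ k) :
    InGermModuleMod (P.rbHormanderFamily Λ N T_L T_R) A x₀
      (fun y => P.bondCoeff k i i' y • (rbUnitP i : RBPhaseSpace N)) := by
  induction k with
  | zero => omega
  | succ k ih =>
    rcases Nat.lt_or_ge k 2 with hlt | hge
    · have : k + 1 = 2 := by omega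
      rw [this]; exact h2
    · rw [← P.lieBracket_rbUnitQ_bondCoeff_smul hV k hii']
      exact hQ.lieBracket (P.rbHormanderFamily_smooth hU hV Λ N T_L T_R) (ih hge)

/-- **The H2 step**: from `∂_{q_{i'}}`, the `∂_{p_l}` (`l ≤ i'`) and H2 at `q_i - q_{i'}`
(`i = i' + 1`), the direction `∂_{p_i}` is in the germ module at `x₀` ("The condition H2 means
that we can write `∂_{p₂}` as a linear combination of these commutators for every `x`").
[cite: ReyBelletThomas2002, Prop 4.1] -/
theorem inGermModuleMod_rbUnitP_succ (hV2 : RBNondegenerate P.V) {x₀ : RBPhaseSpace N}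
    {i i' : Fin N} (hii' : i.val = i'.val + 1)
    (hQ : InGermModuleMod (P.rbHormanderFamily Λ N T_L T_R) A x₀ (fun _ => rbUnitQ i'))
    (hPl : ∀ l : Fin N, l.val ≤ i'.val →
      InGermModuleMod (P.rbHormanderFamily Λ N T_L T_R) A x₀ (fun _ => rbUnitP l)) :
    InGermModuleMod (P.rbHormanderFamily Λ N T_L T_R) A x₀ (fun _ => rbUnitP i) := by
  have hne : i ≠ i' := fun e => by rw [e] at hii'; omega
  -- `Z_2`
  have h2 : InGermModuleMod (P.rbHormanderFamily Λ N T_L T_R) A x₀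
      (fun y => P.bondCoeff 2 i i' y • (rbUnitP i : RBPhaseSpace N)) := by
    have h := P.inGermModuleMod_hess_smul_rbUnitP hU hV hii' hQ hPl
    have e : (fun y : RBPhaseSpace N => P.bondCoeff 2 i i' y • (rbUnitP i : RBPhaseSpace N)) =
        fun y => deriv (deriv P.V) (y.1.1 i - y.1.1 i') • (rbUnitP i : RBPhaseSpace N) := by
      funext y
      simp [bondCoeff, iteratedDeriv_succ, iteratedDeriv_zero]
    rwa [e]
  -- H2 at the bond
  obtain ⟨m, hm, hm0⟩ := hV2 (x₀.1.1 i - x₀.1.1 i')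
  have hZ := P.inGermModuleMod_bondCoeff_smul hU hV hne hQ h2 m hm
  refine InGermModuleMod.of_smul_of_ne_zero
    (Eventually.of_forall fun y => (P.contDiff_bondCoeff hV m i i').contDiffAt) ?_ hZ
  simp only [bondCoeff]
  exact mul_ne_zero (pow_ne_zero _ (by norm_num)) hm0

include hA in
/-- **Prop. 4.1 without the bare drift word**: under H2, `Λ ≠ 0`, `γT_L, γT_R > 0`, the values
at every point of the brackets of LENGTH `≥ 2` of the family `(X₀, X_L, X_R)` together with the
noise fields `X_L, X_R` already span the extended phase space — the bare word `X₀` is never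
needed (the printed sweep starts from `∂_{r_b}` and only ever brackets). This is the input of the
lift to the parabolic operator `∂_t - L` / `L* - ∂_t` (`isBracketGenerating_lift`).
[cite: ReyBelletThomas2002, Prop 4.1] -/
theorem bracketSpanModAt_rbHormanderFamily_eq_top (hV2 : RBNondegenerate P.V) (hΛ : Λ ≠ 0)
    (hL : 0 < P.γ * T_L) (hR : 0 < P.γ * T_R) (x₀ : RBPhaseSpace N) :
    bracketSpanModAt (P.rbHormanderFamily Λ N T_L T_R) A x₀ = ⊤ := by
  -- every coordinate direction is in the germ module at `x₀`, by strong induction on the site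
  have key : ∀ m : ℕ, ∀ i : Fin N, i.val = m →
      InGermModuleMod (P.rbHormanderFamily Λ N T_L T_R) A x₀ (fun _ => rbUnitP i) ∧
        InGermModuleMod (P.rbHormanderFamily Λ N T_L T_R) A x₀ (fun _ => rbUnitQ i) := by
    intro m
    induction m using Nat.strong_induction_on with
    | _ m ih =>
      intro i him
      have hPi : InGermModuleMod (P.rbHormanderFamily Λ N T_L T_R) A x₀ (fun _ => rbUnitP i) := by
        rcases Nat.eq_zero_or_pos m with hm | hm
        · exact P.inGermModuleMod_rbUnitP_zero hU hV hA hΛ hL x₀ i (by omega)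
        · set i' : Fin N := ⟨m - 1, by omega⟩ with hi'
          have hii' : i.val = i'.val + 1 := by simp [hi']; omega
          refine P.inGermModuleMod_rbUnitP_succ hU hV hV2 hii' (ih i'.val (by simp [hi']; omega) i' rfl).2
            fun l hl => (ih l.val (by simp [hi'] at hl; omega) l rfl).1
      exact ⟨hPi, P.inGermModuleMod_rbUnitQ_of_rbUnitP hU hV hA hL hR hPi⟩
  refine bracketSpanModAt_eq_top_of_inGermModuleMod (span_rbUnit_eq_top N) ?_
  rintro v ((⟨i, rfl⟩ | ⟨i, rfl⟩) | (rfl | rfl))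
  · exact (key _ i rfl).2
  · exact (key _ i rfl).1
  · exact P.inGermModuleMod_rbUnitRL hA hL x₀
  · exact P.inGermModuleMod_rbUnitRR hA hR x₀

include hA in
/-- **Prop. 4.1 without the bare drift, for the Fokker–Planck family `(-X₀, X_L, X_R)`** (sign
flip of the drift: rescaling invariance of the restricted span). [cite: ReyBelletThomas2002, Prop 4.1] -/
theorem bracketSpanModAt_rbAdjointFamily_eq_top (hV2 : RBNondegenerate P.V) (hΛ : Λ ≠ 0)
    (hL : 0 < P.γ * T_L) (hR : 0 < P.γ * T_R) (x₀ : RBPhaseSpace N) :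
    bracketSpanModAt (P.rbAdjointFamily Λ N T_L T_R) A x₀ = ⊤ := by
  rw [bracketSpanModAt_eq_of_eq_smul (P.contDiff_rbHormanderFamily hU hV Λ N T_L T_R)
    (P.rbAdjointFamily_eq_smul Λ N T_L T_R) (fun o => by cases o <;> simp) x₀]
  exact P.bracketSpanModAt_rbHormanderFamily_eq_top hU hV hA hV2 hΛ hL hR x₀

end Brackets

/-! ### The family of `L* - ∂_t` on `ℝ × X` and its bracket condition -/

/-- The time components of the lifted fields: `-1` on the drift, `0` on the noise fields.
[folklore] -/
def rbTimeCoeff (o : Option (Fin 2)) : ℝ := Option.elim o (-1) fun _ => 0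

/-- **The family `(X̃₀, X̃_L, X̃_R)` of the parabolic operator `L* - ∂_t = X̃_L² + X̃_R² + X̃₀ + 2γ`
on `ℝ × X`**: `X̃₀ = (-1, -X₀)`, `X̃_b = (0, X_b)` (lifts of the Fokker–Planck family).
[cite: ReyBelletThomas2002, §4] -/
def rbParabolicFamily (Λ : ℝ) (N : ℕ) (T_L T_R : ℝ) :
    Option (Fin 2) → ℝ × RBPhaseSpace N → ℝ × RBPhaseSpace N :=
  fun o => liftField (rbTimeCoeff o) (P.rbAdjointFamily Λ N T_L T_R o)

/-- The parabolic family in Hörmander's `Option.elim` form. [folklore] -/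
theorem rbParabolicFamily_eq_elim (Λ : ℝ) (N : ℕ) (T_L T_R : ℝ) :
    P.rbParabolicFamily Λ N T_L T_R = fun o => o.elim
      (liftField (-1) fun y => -P.rbDrift Λ N y) (fun b => liftField 0 (P.rbBathField T_L T_R b)) := by
  funext o
  cases o <;> rfl

/-- The drift of the parabolic family: `X̃₀(t, y) = (-1, -X₀(y))`. [folklore] -/
@[simp] theorem rbParabolicFamily_none (Λ : ℝ) (N : ℕ) (T_L T_R : ℝ) (p : ℝ × RBPhaseSpace N) :
    P.rbParabolicFamily Λ N T_L T_R none p = (-1, -P.rbDrift Λ N p.2) := rfl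

/-- The noise fields of the parabolic family: `X̃_b(t, y) = (0, X_b)`. [folklore] -/
@[simp] theorem rbParabolicFamily_some (Λ : ℝ) (N : ℕ) (T_L T_R : ℝ) (b : Fin 2)
    (p : ℝ × RBPhaseSpace N) :
    P.rbParabolicFamily Λ N T_L T_R (some b) p = (0, P.rbBathField T_L T_R b p.2) := rfl

/-- All fields of the parabolic family are smooth (smooth potentials). [folklore] -/
theorem contDiff_rbParabolicFamily (hU : ContDiff ℝ ∞ P.U) (hV : ContDiff ℝ ∞ P.V) (Λ : ℝ)
    (N : ℕ) (T_L T_R : ℝ) (o : Option (Fin 2)) : ContDiff ℝ ∞ (P.rbParabolicFamily Λ N T_L T_R o) := by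
  unfold rbParabolicFamily
  refine contDiff_liftField _ ?_
  rw [P.rbAdjointFamily_eq_smul Λ N T_L T_R o]
  exact (P.contDiff_rbHormanderFamily hU hV Λ N T_L T_R o).const_smul (Option.elim o (-1 : ℝ) fun _ => 1)

/-- **The bracket condition for the parabolic operator `L* - ∂_t` of (RBT-SDE), everywhere on
`ℝ × X`**, under H2, `Λ ≠ 0`, `γT_L, γT_R > 0`: from Prop. 4.1 without the bare drift and the
generic lift (brackets kill the constant time components; `X̃₀` supplies the time direction).
[cite: ReyBelletThomas2002, Prop 4.1] -/
theorem isBracketGenerating_rbParabolicFamily (hU : ContDiff ℝ ∞ P.U) (hV : ContDiff ℝ ∞ P.V)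
    {Λ : ℝ} {T_L T_R : ℝ} (hV2 : RBNondegenerate P.V) (hΛ : Λ ≠ 0) (hL : 0 < P.γ * T_L)
    (hR : 0 < P.γ * T_R) : IsBracketGenerating (P.rbParabolicFamily Λ N T_L T_R) univ := by
  have hX : ∀ o, ContDiff ℝ ∞ (P.rbAdjointFamily Λ N T_L T_R o) := fun o => by
    rw [P.rbAdjointFamily_eq_smul Λ N T_L T_R o]
    exact (P.contDiff_rbHormanderFamily hU hV Λ N T_L T_R o).const_smul (Option.elim o (-1 : ℝ) fun _ => 1)
  have hA : ∀ b : Fin 2, some b ∈ {o : Option (Fin 2) | rbTimeCoeff o = 0} := fun b => by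
    simp [rbTimeCoeff]
  have h := isBracketGenerating_lift rbTimeCoeff hX (s := univ)
    (fun y _ => P.bracketSpanModAt_rbAdjointFamily_eq_top hU hV hA hV2 hΛ hL hR y)
    (i₀ := none) (by simp [rbTimeCoeff])
  rwa [univ_prod_univ] at h

end OscillatorChain

end Literature.MathematicalPhysics.KineticTheory.HeatConduction
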